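import Summits.ValiantsHypothesis.ValiantsHypothesis.Theorems.PolyaContinuedPfaffianNormalForm
import Literature.Barriers.ValiantsHypothesis.MonotoneGapPermanentLower
import Literature.Computability.AlgebraicComplexity.PermanentVsDeterminantProofs

/-!
# PolyaContinued / CoverDecancellation — the two SUPPORTS of line `laplace_rigidity`, sorry-free

(val-idea-10 g0, 2026-08-28.)  Landable verbatim as a `Theorems/` file; published as the crux
workfile `Cruxes/CoverDecancellation/Lines/laplace_rigidity_supports.lean`.

* `coverCut` — **cutting a cover**: a complex Pfaffian cover of `per_n` of size `m` (a bipartite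
  graph `E` on `m + m` vertices with a Pfaffian signing and a Valiant projection of its
  perfect-matching polynomial onto `per_n`) yields a `(⌊n/2⌋, ⌈n/2⌉)` two-factor decomposition
  `per_n = Σ_{i<w} p_i q_i` (`p_i`, `q_i` homogeneous of degrees `⌊n/2⌋`, `⌈n/2⌉`) of width
  `w ≤ 2 (2m³ + 2) ≤ 2^{6(log₂ m + 1)}`: cover ⇒ affine determinantal representation ⇒
  Mahajan–Vinay layered affine DAG (tree: `exists_dag_of_isAffineDetRepr`) ⇒ `homogeneous_cut`
  (split `Λ = Λ₀ + Λ₁` into constant and linear part, `(1-Λ)⁻¹ = (Σ_d (N₀Λ₁)^d) N₀` with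
  `N₀ = (1-Λ₀)⁻¹`, take the degree-`n` component, cut `(N₀Λ₁)^n = (N₀Λ₁)^k (N₀Λ₁)^{n-k}`).
* `zeroOneGrenet` — **Grenet's cover is 0/1**: for every `n` a Pfaffian cover of `per_n` of size
  `2^n + 1 ≤ 2^{n+1}` whose projection uses only variables, `0` and `1` (Grenet's subset-lattice
  program, tree: `Grenet.adjugate_one_sub_empty_univ`, through `exists_zeroOneCover_of_ranked`,
  the tree's `exists_pfaffianCover_of_ranked` re-run keeping track of the labels).

With these, the line's composition gives `CentralLaplaceRigidity → CoverDecancellation` outright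
(`coverDecancellation_of_centralLaplaceRigidity` in `Lines/laplace_rigidity.lean`).
-/

-- single-conjunct layout: Sub = Summit, duplicated namespace component intended
set_option linter.dupNamespace false

open MvPolynomial Matrix

namespace Summit.ValiantsHypothesis.ValiantsHypothesis.Theorems.PolyaContinued.LaplaceRigidity


variable {σ : Type*} {ι : Type*} [Fintype ι] [DecidableEq ι]

omit [DecidableEq ι] in
/-- Entrywise homogeneity is multiplicative: degrees add under the matrix product. -/
theorem homEntries_mul {M M' : Matrix ι ι (MvPolynomial σ ℂ)} {a b : ℕ} (h : (∀ i j, (M i j).IsHomogeneous a))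
    (h' : (∀ i j, (M' i j).IsHomogeneous b)) : (∀ i j, ((M * M') i j).IsHomogeneous (a + b)) := by
  intro i j
  rw [Matrix.mul_apply]
  exact IsHomogeneous.sum _ _ _ fun l _ => (h i l).mul (h' l j)

omit [Fintype ι] in
/-- The identity matrix has entries homogeneous of degree `0`. -/
theorem homEntries_one : (∀ i j, ((1 : Matrix ι ι (MvPolynomial σ ℂ)) i j).IsHomogeneous 0) := by
  intro i j
  rw [Matrix.one_apply]
  split_ifs
  · exact isHomogeneous_one σ ℂ
  · exact isHomogeneous_zero σ ℂ 0

/-- Powers of a matrix with degree-`a` entries have degree-`d·a` entries. -/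
theorem homEntries_pow {M : Matrix ι ι (MvPolynomial σ ℂ)} {a : ℕ} (h : (∀ i j, (M i j).IsHomogeneous a)) :
    ∀ d : ℕ, (∀ i j, ((M ^ d) i j).IsHomogeneous (d * a))
  | 0 => by rw [pow_zero, zero_mul]; exact homEntries_one
  | d + 1 => by rw [pow_succ, Nat.succ_mul]; exact homEntries_mul (homEntries_pow h d) h

omit [Fintype ι] [DecidableEq ι] in
/-- A sum of matrices with degree-`a` entries has degree-`a` entries. -/
theorem homEntries_sum {s : Finset ℕ} {F : ℕ → Matrix ι ι (MvPolynomial σ ℂ)} {a : ℕ}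
    (h : ∀ d ∈ s, (∀ i j, ((F d) i j).IsHomogeneous a)) : (∀ i j, ((∑ d ∈ s, F d) i j).IsHomogeneous a) := by
  intro i j
  rw [Matrix.sum_apply]
  exact IsHomogeneous.sum _ _ _ fun d hd => h d hd i j

omit [DecidableEq ι] in
/-- Matrix × vector: degrees add. -/
theorem homEntries_mulVec {M : Matrix ι ι (MvPolynomial σ ℂ)} {a b : ℕ} {v : ι → MvPolynomial σ ℂ}
    (h : (∀ i j, (M i j).IsHomogeneous a)) (hv : (∀ i, (v i).IsHomogeneous b)) : (∀ i, ((M *ᵥ v) i).IsHomogeneous (a + b)) := by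
  intro i
  change IsHomogeneous (∑ j, M i j * v j) _
  exact IsHomogeneous.sum _ _ _ fun j _ => (h i j).mul (hv j)

omit [DecidableEq ι] in
/-- Vector × matrix: degrees add. -/
theorem homVec_vecMul {M : Matrix ι ι (MvPolynomial σ ℂ)} {a b : ℕ} {v : ι → MvPolynomial σ ℂ}
    (hv : (∀ i, (v i).IsHomogeneous b)) (h : (∀ i j, (M i j).IsHomogeneous a)) : (∀ i, ((v ᵥ* M) i).IsHomogeneous (b + a)) := by
  intro j
  change IsHomogeneous (∑ i, v i * M i j) _
  exact IsHomogeneous.sum _ _ _ fun i _ => (hv i).mul (h i j)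

omit [DecidableEq ι] in
/-- Dot product of homogeneous vectors: degrees add. -/
theorem homVec_dotProduct {v w : ι → MvPolynomial σ ℂ} {a b : ℕ} (hv : (∀ i, (v i).IsHomogeneous a))
    (hw : (∀ i, (w i).IsHomogeneous b)) : (v ⬝ᵥ w).IsHomogeneous (a + b) :=
  IsHomogeneous.sum _ _ _ fun i _ => (hv i).mul (hw i)

omit [DecidableEq ι] in
/-- Layering gaps add under the matrix product. -/
theorem layered_mul {r : ι → ℕ} {M M' : Matrix ι ι (MvPolynomial σ ℂ)} {a b : ℕ}
    (h : (∀ i j, M i j ≠ 0 → r i + a ≤ r j)) (h' : (∀ i j, M' i j ≠ 0 → r i + b ≤ r j)) : (∀ i j, (M * M') i j ≠ 0 → r i + (a + b) ≤ r j) := by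
  intro i j hij
  rw [Matrix.mul_apply] at hij
  obtain ⟨l, -, hl⟩ := Finset.exists_ne_zero_of_sum_ne_zero hij
  have h1 : M i l ≠ 0 := fun h0 => hl (by rw [h0, zero_mul])
  have h2 : M' l j ≠ 0 := fun h0 => hl (by rw [h0, mul_zero])
  have := h i l h1
  have := h' l j h2
  omega

omit [Fintype ι] in
/-- The identity matrix is layered with gap `0`. -/
theorem layered_one {r : ι → ℕ} : (∀ i j, (1 : Matrix ι ι (MvPolynomial σ ℂ)) i j ≠ 0 → r i + 0 ≤ r j) := by
  intro i j hij
  by_cases h : i = j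
  · subst h; simp
  · exact absurd (Matrix.one_apply_ne h) hij

/-- The `d`-th power of a gap-`a` layered matrix is layered with gap `d·a`. -/
theorem layered_pow {r : ι → ℕ} {M : Matrix ι ι (MvPolynomial σ ℂ)} {a : ℕ} (h : (∀ i j, M i j ≠ 0 → r i + a ≤ r j)) :
    ∀ d : ℕ, (∀ i j, (M ^ d) i j ≠ 0 → r i + (d * a) ≤ r j)
  | 0 => by rw [pow_zero, zero_mul]; exact layered_one
  | d + 1 => by rw [pow_succ, Nat.succ_mul]; exact layered_mul (layered_pow h d) h

omit [Fintype ι] [DecidableEq ι] in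
/-- A sum of gap-`a` layered matrices is layered with gap `a`. -/
theorem layered_sum {r : ι → ℕ} {s : Finset ℕ} {F : ℕ → Matrix ι ι (MvPolynomial σ ℂ)} {a : ℕ}
    (h : ∀ d ∈ s, (∀ i j, (F d) i j ≠ 0 → r i + a ≤ r j)) : (∀ i j, (∑ d ∈ s, F d) i j ≠ 0 → r i + a ≤ r j) := by
  intro i j hij
  rw [Matrix.sum_apply] at hij
  obtain ⟨d, hd, hdij⟩ := Finset.exists_ne_zero_of_sum_ne_zero hij
  exact h d hd i j hdij

omit [Fintype ι] [DecidableEq ι] in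
/-- Layering is monotone in the gap. -/
theorem layered_mono {r : ι → ℕ} {M : Matrix ι ι (MvPolynomial σ ℂ)} {a b : ℕ} (hab : b ≤ a)
    (h : (∀ i j, M i j ≠ 0 → r i + a ≤ r j)) : (∀ i j, M i j ≠ 0 → r i + b ≤ r j) := fun i j hij => by have := h i j hij; omega

/-- A gap-`1` layered matrix is nilpotent: `M ^ L = 0` once `L` exceeds every rank. -/
theorem layered_pow_eq_zero {r : ι → ℕ} {M : Matrix ι ι (MvPolynomial σ ℂ)} (h : (∀ i j, M i j ≠ 0 → r i + 1 ≤ r j))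
    {L : ℕ} (hL : ∀ v, r v < L) : M ^ L = 0 := by
  refine Matrix.ext fun i j => ?_
  rw [Matrix.zero_apply]
  by_contra hne
  have := (layered_pow h L) i j hne
  have := hL j
  omega

/-- An affine polynomial splits as constant part + linear part. -/
theorem affine_split (φ : MvPolynomial σ ℂ) (h : φ.totalDegree ≤ 1) :
    φ = C (coeff 0 φ) + homogeneousComponent 1 φ := by
  have hs := sum_homogeneousComponent φ
  rw [← homogeneousComponent_zero]
  rcases Nat.lt_or_ge φ.totalDegree 1 with h0 | h1
  · have h00 : φ.totalDegree = 0 := by omega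
    rw [h00] at hs
    rw [homogeneousComponent_eq_zero 1 φ h0, add_zero]
    simpa using hs.symm
  · have h11 : φ.totalDegree = 1 := le_antisymm h h1
    rw [h11] at hs
    simpa [Finset.sum_range_succ] using hs.symm

omit [DecidableEq ι] in
/-- `(∑ F d) *ᵥ v = ∑ (F d *ᵥ v)` over a `Finset ℕ`. -/
theorem sum_mulVec (s : Finset ℕ) (F : ℕ → Matrix ι ι (MvPolynomial σ ℂ)) (v : ι → MvPolynomial σ ℂ) :
    (∑ d ∈ s, F d) *ᵥ v = ∑ d ∈ s, F d *ᵥ v := by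
  classical
  induction s using Finset.induction_on with
  | empty => simp
  | insert a s ha ih => rw [Finset.sum_insert ha, Finset.sum_insert ha, Matrix.add_mulVec, ih]

omit [DecidableEq ι] in
/-- `u ⬝ᵥ (∑ w d) = ∑ (u ⬝ᵥ w d)` over a `Finset ℕ`. -/
theorem dotProduct_sum' (u : ι → MvPolynomial σ ℂ) (s : Finset ℕ) (w : ℕ → ι → MvPolynomial σ ℂ) :
    u ⬝ᵥ (∑ d ∈ s, w d) = ∑ d ∈ s, u ⬝ᵥ w d := by
  classical
  induction s using Finset.induction_on with
  | empty => simp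
  | insert a s ha ih => rw [Finset.sum_insert ha, Finset.sum_insert ha, dotProduct_add, ih]

/-- **Homogeneous cut of a layered affine DAG.**  If `f = src ⬝ G snk` with `(1 - Λ) G = 1`,
`Λ` strictly layered with affine entries, `src` affine, `snk` constant, and `f` is homogeneous of
degree `n`, then for every `1 ≤ k ≤ n`, `f = Σ_{v ∈ ι ⊕ ι} p_v q_v` with every `p_v` homogeneous
of degree `k` and every `q_v` homogeneous of degree `n - k` (cut the degree-graded path sums at
degree `k`).  [cite: Nisan1991, §4 (homogeneous ABP layers); MahajanVinay1997, §3] -/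
theorem homogeneous_cut (r : ι → ℕ) (Λ G : Matrix ι ι (MvPolynomial σ ℂ))
    (src snk : ι → MvPolynomial σ ℂ) (f : MvPolynomial σ ℂ) (n k : ℕ)
    (hΛr : ∀ i j, Λ i j ≠ 0 → r i < r j) (hΛd : ∀ i j, (Λ i j).totalDegree ≤ 1)
    (hsrc : ∀ i, (src i).totalDegree ≤ 1) (hsnk : ∀ i, ∃ c, snk i = C c)
    (hG : (1 - Λ) * G = 1) (hf : src ⬝ᵥ (G *ᵥ snk) = f) (hfn : f.IsHomogeneous n)
    (hk1 : 1 ≤ k) (hkn : k ≤ n) :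
    ∃ p q : ι ⊕ ι → MvPolynomial σ ℂ, (∀ v, (p v).IsHomogeneous k) ∧
      (∀ v, (q v).IsHomogeneous (n - k)) ∧ f = ∑ v, p v * q v := by
  classical
  -- constant / linear parts
  set Λ₀ : Matrix ι ι (MvPolynomial σ ℂ) := Matrix.of fun i j => C (coeff 0 (Λ i j)) with hΛ₀
  set Λ₁ : Matrix ι ι (MvPolynomial σ ℂ) := Matrix.of fun i j => homogeneousComponent 1 (Λ i j)
    with hΛ₁
  set s₀ : ι → MvPolynomial σ ℂ := fun i => C (coeff 0 (src i)) with hs₀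
  set s₁ : ι → MvPolynomial σ ℂ := fun i => homogeneousComponent 1 (src i) with hs₁
  have hΛsplit : Λ = Λ₀ + Λ₁ := by
    refine Matrix.ext fun i j => ?_
    rw [Matrix.add_apply, hΛ₀, hΛ₁, Matrix.of_apply, Matrix.of_apply]
    exact affine_split _ (hΛd i j)
  have hsrcsplit : src = s₀ + s₁ := by
    funext i
    rw [Pi.add_apply]
    exact affine_split _ (hsrc i)
  have hΛ₀h : (∀ i j, (Λ₀ i j).IsHomogeneous 0) := fun i j => by rw [hΛ₀, Matrix.of_apply]; exact isHomogeneous_C _ _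
  have hΛ₁h : (∀ i j, (Λ₁ i j).IsHomogeneous 1) := fun i j => by
    rw [hΛ₁, Matrix.of_apply]; exact homogeneousComponent_isHomogeneous 1 _
  have hs₀h : (∀ i, (s₀ i).IsHomogeneous 0) := fun i => isHomogeneous_C _ _
  have hs₁h : (∀ i, (s₁ i).IsHomogeneous 1) := fun i => homogeneousComponent_isHomogeneous 1 _
  have hsnkh : (∀ i, (snk i).IsHomogeneous 0) := fun i => by
    obtain ⟨c, hc⟩ := hsnk i; rw [hc]; exact isHomogeneous_C _ _
  have hΛ₀l : (∀ i j, Λ₀ i j ≠ 0 → r i + 1 ≤ r j) := by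
    intro i j hij
    rw [hΛ₀, Matrix.of_apply] at hij
    have : Λ i j ≠ 0 := by
      intro h0; apply hij; rw [h0, coeff_zero, C_0]
    exact hΛr i j this
  have hΛ₁l : (∀ i j, Λ₁ i j ≠ 0 → r i + 1 ≤ r j) := by
    intro i j hij
    rw [hΛ₁, Matrix.of_apply] at hij
    have : Λ i j ≠ 0 := by
      intro h0; apply hij; rw [h0, map_zero]
    exact hΛr i j this
  -- nilpotency index (also larger than `n + 1`, for the bookkeeping below)
  set L : ℕ := Finset.univ.sup r + n + 2 with hLdef
  have hL : ∀ v, r v < L := fun v => by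
    have := Finset.le_sup (f := r) (Finset.mem_univ v); omega
  -- N₀ = (1 - Λ₀)⁻¹
  set N₀ : Matrix ι ι (MvPolynomial σ ℂ) := ∑ d ∈ Finset.range L, Λ₀ ^ d with hN₀
  have h10 : (1 - Λ₀) * N₀ = 1 := by
    rw [hN₀, mul_neg_geom_sum, layered_pow_eq_zero hΛ₀l hL, sub_zero]
  have hN₀h : (∀ i j, (N₀ i j).IsHomogeneous 0) :=
    homEntries_sum fun d _ => by simpa using homEntries_pow hΛ₀h d
  have hN₀l : (∀ i j, N₀ i j ≠ 0 → r i + 0 ≤ r j) :=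
    layered_sum fun d _ => layered_mono (Nat.zero_le _) (layered_pow hΛ₀l d)
  -- M = N₀ Λ₁ : strictly layered, linear entries
  set M : Matrix ι ι (MvPolynomial σ ℂ) := N₀ * Λ₁ with hM
  have hMh : (∀ i j, (M i j).IsHomogeneous 1) := by simpa using homEntries_mul hN₀h hΛ₁h
  have hMl : (∀ i j, M i j ≠ 0 → r i + 1 ≤ r j) := by simpa using layered_mul hN₀l hΛ₁l
  have hM0 : M ^ L = 0 := layered_pow_eq_zero hMl hL
  -- the explicit inverse
  set G' : Matrix ι ι (MvPolynomial σ ℂ) := (∑ d ∈ Finset.range L, M ^ d) * N₀ with hG'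
  have e1 : (1 - Λ₀) * (1 - M) = 1 - Λ := by
    rw [mul_sub, mul_one, hM, ← Matrix.mul_assoc, h10, Matrix.one_mul, hΛsplit, sub_sub]
  have hG'1 : (1 - Λ) * G' = 1 := by
    rw [← e1, hG', Matrix.mul_assoc, ← Matrix.mul_assoc (1 - M), mul_neg_geom_sum, hM0, sub_zero,
      Matrix.one_mul, h10]
  have hGG' : G = G' := by
    have h1 : G * (1 - Λ) = 1 := mul_eq_one_comm.mp hG
    calc G = G * ((1 - Λ) * G') := by rw [hG'1, Matrix.mul_one]
      _ = G' := by rw [← Matrix.mul_assoc, h1, Matrix.one_mul]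
  -- graded pieces
  set Q : ℕ → ι → MvPolynomial σ ℂ := fun d => (M ^ d * N₀) *ᵥ snk with hQ
  have hQh : ∀ d, (∀ i, ((Q d) i).IsHomogeneous d) := fun d => by
    have : (∀ i j, ((M ^ d * N₀) i j).IsHomogeneous d) := by simpa using homEntries_mul (homEntries_pow hMh d) hN₀h
    simpa using homEntries_mulVec this hsnkh
  have hT : ∀ d, (s₀ ⬝ᵥ Q d).IsHomogeneous d := fun d => by simpa using homVec_dotProduct hs₀h (hQh d)
  have hU : ∀ d, (s₁ ⬝ᵥ Q d).IsHomogeneous (d + 1) := fun d => by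
    simpa [add_comm] using homVec_dotProduct hs₁h (hQh d)
  have hfsum : f = ∑ d ∈ Finset.range L, (s₀ ⬝ᵥ Q d + s₁ ⬝ᵥ Q d) := by
    rw [← hf, hGG', hG', Finset.sum_mul, sum_mulVec, dotProduct_sum', hsrcsplit]
    refine Finset.sum_congr rfl fun d _ => ?_
    rw [add_dotProduct]
  -- extract the degree-n component
  have hn1 : 1 ≤ n := hk1.trans hkn
  have hfcomp : f = s₀ ⬝ᵥ Q n + s₁ ⬝ᵥ Q (n - 1) := by
    have hc : homogeneousComponent n f = f := by
      rw [homogeneousComponent_of_mem (mem_homogeneousSubmodule n f |>.mpr hfn), if_pos rfl]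
    rw [← hc, hfsum, map_sum]
    simp_rw [map_add]
    rw [Finset.sum_add_distrib]
    have hA : ∀ d, homogeneousComponent n (s₀ ⬝ᵥ Q d) = if n = d then s₀ ⬝ᵥ Q d else 0 := fun d =>
      homogeneousComponent_of_mem ((mem_homogeneousSubmodule d _).mpr (hT d))
    have hB : ∀ d, homogeneousComponent n (s₁ ⬝ᵥ Q d) = if n - 1 = d then s₁ ⬝ᵥ Q d else 0 := by
      intro d
      rw [homogeneousComponent_of_mem ((mem_homogeneousSubmodule (d + 1) _).mpr (hU d))]
      have : (n = d + 1) ↔ (n - 1 = d) := by omega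
      simp only [this]
    simp_rw [hA, hB]
    rw [Finset.sum_ite_eq, Finset.sum_ite_eq, if_pos (Finset.mem_range.mpr (by omega)),
      if_pos (Finset.mem_range.mpr (by omega))]
  -- the cut
  have hcutT : s₀ ⬝ᵥ Q n = (s₀ ᵥ* M ^ k) ⬝ᵥ Q (n - k) := by
    rw [hQ]
    dsimp only
    rw [show n = k + (n - k) from (Nat.add_sub_cancel' hkn).symm, pow_add, Nat.add_sub_cancel_left,
      Matrix.mul_assoc, ← Matrix.mulVec_mulVec, dotProduct_mulVec]
  have hcutU : s₁ ⬝ᵥ Q (n - 1) = (s₁ ᵥ* M ^ (k - 1)) ⬝ᵥ Q (n - k) := by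
    rw [hQ]
    dsimp only
    rw [show n - 1 = (k - 1) + (n - k) by omega, pow_add, Matrix.mul_assoc, ← Matrix.mulVec_mulVec,
      dotProduct_mulVec]
  refine ⟨Sum.elim (s₀ ᵥ* M ^ k) (s₁ ᵥ* M ^ (k - 1)), Sum.elim (Q (n - k)) (Q (n - k)), ?_, ?_, ?_⟩
  · rintro (v | v)
    · simpa using (homVec_vecMul hs₀h (homEntries_pow hMh k)) v
    · have := (homVec_vecMul hs₁h (homEntries_pow hMh (k - 1))) v
      simpa [show 1 + (k - 1) = k by omega] using this
  · rintro (v | v) <;> simpa using hQh (n - k) v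
  · rw [hfcomp, hcutT, hcutU, Fintype.sum_sum_type]
    simp only [Sum.elim_inl, Sum.elim_inr]
    rfl


/-! ## Stage 2: complex Pfaffian cover ⇒ affine determinantal representation ⇒ central cut -/

open Literature.Computability.AlgebraicComplexity in
/-- A complex Pfaffian cover of size `m ≠ 0` yields an affine determinantal representation of
`per_n` of size `m`: substitute the projection into the signed cover matrix. [cite: Valiant1979, §2] -/
theorem exists_affineDetRepr_of_cover {n m : ℕ}
    (h : (∃ (E : Finset (Fin m × Fin m)) (P : MvPolynomial (Fin m × Fin m) ℂ),
      P = (Matrix.of fun i j => if (i, j) ∈ E then MvPolynomial.X (i, j) else 0 :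
        Matrix (Fin m) (Fin m) (MvPolynomial (Fin m × Fin m) ℂ)).permanent ∧
      (∃ s : Fin m × Fin m → ℂ, (∀ e, s e = 1 ∨ s e = -1) ∧
        (Matrix.of fun i j => if (i, j) ∈ E then MvPolynomial.C (s (i, j)) * MvPolynomial.X (i, j)
          else 0 : Matrix (Fin m) (Fin m) (MvPolynomial (Fin m × Fin m) ℂ)).det = P) ∧
      Literature.Computability.AlgebraicComplexity.IsProjection
        (Literature.Computability.AlgebraicComplexity.perPoly (Fin n) ℂ) P)) :
    ∃ A : Matrix (Fin m) (Fin m) (MvPolynomial (Fin n × Fin n) ℂ),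
      IsAffineDetRepr (perPoly (Fin n) ℂ) A := by
  obtain ⟨E, P, -, ⟨s, -, hdet⟩, a, ha, hper⟩ := h
  refine ⟨(aeval a).mapMatrix (Matrix.of fun i j =>
      if (i, j) ∈ E then C (s (i, j)) * X (i, j) else 0), ?_, ?_⟩
  · intro i j
    rw [AlgHom.mapMatrix_apply, Matrix.map_apply, Matrix.of_apply]
    by_cases he : (i, j) ∈ E
    · rw [if_pos he, map_mul, aeval_C, aeval_X, MvPolynomial.algebraMap_eq]
      rcases ha (i, j) with ⟨j', hj'⟩ | ⟨c, hc⟩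
      · rw [hj']
        refine (totalDegree_mul _ _).trans ?_
        rw [totalDegree_C, totalDegree_X, zero_add]
      · rw [hc, ← map_mul, totalDegree_C]; exact Nat.zero_le _
    · rw [if_neg he, map_zero, totalDegree_zero]; exact Nat.zero_le _
  · rw [← AlgHom.map_det, hdet, ← hper]

open Literature.Computability.AlgebraicComplexity in
/-- `per_n ≠ 0` (the identity permutation's monomial has coefficient `1`). -/
theorem perPoly_fin_ne_zero (n : ℕ) : perPoly (Fin n) ℂ ≠ 0 := by
  intro h
  have := Literature.Barriers.ValiantsHypothesis.JerrumSnir.card_support_perPoly (n := n) (R := ℂ)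
  rw [h, support_zero, Finset.card_empty] at this
  exact absurd this.symm (Nat.factorial_ne_zero n)

/-- The Mahajan–Vinay vertex type has `2m³ + 2` elements. -/
theorem card_vtx' (m : ℕ) :
    Fintype.card (Literature.Computability.AlgebraicComplexity.GKKP2011.Vtx m) = 2 * m ^ 3 + 2 := by
  simp only [Fintype.card_sum, Fintype.card_prod, Fintype.card_fin, Fintype.card_bool]
  ring

/-- Width bookkeeping: `2(2m³ + 2) ≤ 2^{6(log₂ m + 1)}`. -/
theorem width_bound (m : ℕ) : 2 * (2 * m ^ 3 + 2) ≤ 2 ^ (6 * (Nat.log 2 m + 1)) := by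
  set t : ℕ := 2 ^ (Nat.log 2 m + 1) with ht
  have hmt : m < t := Nat.lt_pow_succ_log_self (by norm_num) m
  have ht2 : 2 ≤ t := by
    rw [ht]
    calc (2 : ℕ) = 2 ^ 1 := by norm_num
      _ ≤ 2 ^ (Nat.log 2 m + 1) := Nat.pow_le_pow_right (by norm_num) (by omega)
  have hm3 : m ^ 3 < t ^ 3 := Nat.pow_lt_pow_left hmt (by norm_num)
  have h8 : 8 ≤ t ^ 3 := by
    calc (8 : ℕ) = 2 ^ 3 := by norm_num
      _ ≤ t ^ 3 := Nat.pow_le_pow_left ht2 3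
  rw [pow_mul', ← ht]
  calc 2 * (2 * m ^ 3 + 2) ≤ 8 * t ^ 3 := by linarith
    _ ≤ t ^ 3 * t ^ 3 := Nat.mul_le_mul_right _ h8
    _ = t ^ 6 := by ring

open Literature.Computability.AlgebraicComplexity in
/-- **stub_coverCut, proved.**  A complex Pfaffian cover of size `m` of `per_n` yields a
`(⌊n/2⌋, ⌈n/2⌉)` two-factor decomposition of width `≤ 2 (2 m³ + 2) ≤ 2^{6 (log₂ m + 1)}`:
cover ⇒ affine determinantal representation (`exists_affineDetRepr_of_cover`) ⇒ layered affine
DAG on `2m³ + 2` vertices (`exists_dag_of_isAffineDetRepr`, Mahajan–Vinay) ⇒ homogeneous cut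
at degree `⌊n/2⌋` (`homogeneous_cut`). [cite: MahajanVinay1997, §3; Nisan1991, §4] -/
theorem coverCut :
    ∃ c₂ : ℕ, ∀ n m : ℕ,
      (∃ (E : Finset (Fin m × Fin m)) (P : MvPolynomial (Fin m × Fin m) ℂ),
      P = (Matrix.of fun i j => if (i, j) ∈ E then MvPolynomial.X (i, j) else 0 :
        Matrix (Fin m) (Fin m) (MvPolynomial (Fin m × Fin m) ℂ)).permanent ∧
      (∃ s : Fin m × Fin m → ℂ, (∀ e, s e = 1 ∨ s e = -1) ∧
        (Matrix.of fun i j => if (i, j) ∈ E then MvPolynomial.C (s (i, j)) * MvPolynomial.X (i, j)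
          else 0 : Matrix (Fin m) (Fin m) (MvPolynomial (Fin m × Fin m) ℂ)).det = P) ∧
      Literature.Computability.AlgebraicComplexity.IsProjection
        (Literature.Computability.AlgebraicComplexity.perPoly (Fin n) ℂ) P) →
      ∃ w : ℕ, w ≤ 2 ^ (c₂ * (Nat.log 2 m + 1)) ∧
        ∃ p q : Fin w → MvPolynomial (Fin n × Fin n) ℂ,
          (∀ i, (p i).IsHomogeneous (n / 2)) ∧ (∀ i, (q i).IsHomogeneous (n - n / 2)) ∧
            Literature.Computability.AlgebraicComplexity.perPoly (Fin n) ℂ = ∑ i, p i * q i := by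
  refine ⟨6, fun n m hcov => ?_⟩
  rcases Nat.lt_or_ge n 2 with hn | hn
  · -- n ≤ 1: the trivial decomposition `per_n = 1 · per_n` of format (0, n)
    have hk : n / 2 = 0 := Nat.div_eq_of_lt hn
    refine ⟨1, Nat.one_le_two_pow, fun _ => 1, fun _ => perPoly (Fin n) ℂ, ?_, ?_, ?_⟩
    · intro _; rw [hk]; exact isHomogeneous_one _ _
    · intro _; rw [hk, Nat.sub_zero]
      simpa using (perPoly_isHomogeneous (n := Fin n) (k := ℂ))
    · simp
  · have hm : m ≠ 0 := by
      rintro rfl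
      obtain ⟨E, P, -, ⟨s, -, hdet⟩, a, -, hper⟩ := hcov
      rw [Matrix.det_isEmpty] at hdet
      rw [← hdet, map_one] at hper
      have h1 := (perPoly_isHomogeneous (n := Fin n) (k := ℂ)).totalDegree (perPoly_fin_ne_zero n)
      rw [hper, totalDegree_one, Fintype.card_fin] at h1
      omega
    obtain ⟨A, hA⟩ := exists_affineDetRepr_of_cover hcov
    obtain ⟨Λ, G, src, snk, hΛr, hΛd, hsrc, hsnk, hG, hf⟩ :=
      Summit.ValiantsHypothesis.ValiantsHypothesis.Theorems.PolyaContinued.exists_dag_of_isAffineDetRepr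
        (perPoly (Fin n) ℂ) hm A hA
    have hhom : (perPoly (Fin n) ℂ).IsHomogeneous n := by
      simpa using (perPoly_isHomogeneous (n := Fin n) (k := ℂ))
    obtain ⟨p, q, hp, hq, hsum⟩ := homogeneous_cut (GKKP2011.layerFn m) Λ G src snk
      (perPoly (Fin n) ℂ) n (n / 2) hΛr hΛd hsrc hsnk hG hf hhom (by omega) (Nat.div_le_self n 2)
    refine ⟨Fintype.card (GKKP2011.Vtx m ⊕ GKKP2011.Vtx m), ?_,
      fun i => p ((Fintype.equivFin (GKKP2011.Vtx m ⊕ GKKP2011.Vtx m)).symm i),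
      fun i => q ((Fintype.equivFin (GKKP2011.Vtx m ⊕ GKKP2011.Vtx m)).symm i),
      fun i => hp _, fun i => hq _, ?_⟩
    · have : Fintype.card (GKKP2011.Vtx m ⊕ GKKP2011.Vtx m) = 2 * (2 * m ^ 3 + 2) := by
        rw [Fintype.card_sum, card_vtx']; ring
      rw [this]; exact width_bound m
    · rw [hsum]
      exact (Equiv.sum_comp (Fintype.equivFin (GKKP2011.Vtx m ⊕ GKKP2011.Vtx m)).symm
        (fun v => p v * q v)).symm


section Grenet
open Equiv Finset
open Summit.ValiantsHypothesis.ValiantsHypothesis.Theorems.PolyaContinued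


/-- **0/1 Pfaffian cover of a ranked branching program with 0/1/variable weights** — the tree's
`exists_pfaffianCover_of_ranked` re-run keeping track of the substituted values: if the weights of
`Λ`, `v`, `w` are variables, `0` or `1`, so is the projection. [folklore; Valiant 1979 §2] -/
theorem exists_zeroOneCover_of_ranked {k : Type*} [CommRing k] {σ : Type*} {ι : Type}
    [Fintype ι] [DecidableEq ι] (r : ι → ℕ) (Λ G : Matrix ι ι (MvPolynomial σ k))
    (v w : ι → MvPolynomial σ k) (f : MvPolynomial σ k)
    (hΛr : ∀ i j, Λ i j ≠ 0 → r i < r j)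
    (hΛe : ∀ i j, (∃ x, Λ i j = X x) ∨ Λ i j = 0 ∨ Λ i j = 1)
    (hv : ∀ i, (∃ x, v i = X x) ∨ v i = 0 ∨ v i = 1)
    (hw : ∀ i, (∃ x, w i = X x) ∨ w i = 0 ∨ w i = 1)
    (hG : (1 - Λ) * G = 1) (hf : v ⬝ᵥ (G *ᵥ w) = f) :
    ∃ (E : Finset (Fin (Fintype.card ι + 1) × Fin (Fintype.card ι + 1)))
      (P : MvPolynomial (Fin (Fintype.card ι + 1) × Fin (Fintype.card ι + 1)) k),
      P = (Matrix.of fun i j => if (i, j) ∈ E then X (i, j) else 0 :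
        Matrix (Fin (Fintype.card ι + 1)) (Fin (Fintype.card ι + 1))
          (MvPolynomial (Fin (Fintype.card ι + 1) × Fin (Fintype.card ι + 1)) k)).permanent ∧
      (∃ s : Fin (Fintype.card ι + 1) × Fin (Fintype.card ι + 1) → k,
        (∀ e, s e = 1 ∨ s e = -1) ∧
        (Matrix.of fun i j => if (i, j) ∈ E then C (s (i, j)) * X (i, j) else 0 :
          Matrix (Fin (Fintype.card ι + 1)) (Fin (Fintype.card ι + 1))
            (MvPolynomial (Fin (Fintype.card ι + 1) × Fin (Fintype.card ι + 1)) k)).det = P) ∧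
      ∃ a : Fin (Fintype.card ι + 1) × Fin (Fintype.card ι + 1) → MvPolynomial σ k,
        (∀ e, (∃ j, a e = X j) ∨ a e = 0 ∨ a e = 1) ∧ f = aeval a P := by
  classical
  -- indexing: `κ = ι ⊕ Unit ≃ Fin (#ι + 1)`, super-vertex `o`
  have hcard : Fintype.card (ι ⊕ Unit) = Fintype.card ι + 1 := by
    rw [Fintype.card_sum, Fintype.card_unit]
  set m' := Fintype.card ι + 1 with hm'
  let e : ι ⊕ Unit ≃ Fin m' := Fintype.equivFinOfCardEq hcard
  let o : Fin m' := e (Sum.inr ())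
  let r' : Fin m' → ℕ := fun p => Sum.elim r (fun _ => 0) (e.symm p)
  have heo : ∀ p' : ι ⊕ Unit, e p' = o ↔ p' = Sum.inr () := fun p' => e.injective.eq_iff
  have hr' : ∀ p' : ι ⊕ Unit, r' (e p') = Sum.elim r (fun _ => 0) p' := fun p' => by
    simp [r']
  let E : Finset (Fin m' × Fin m') := Finset.univ.filter fun pq =>
    (pq.1 ≠ o ∧ pq.2 = o) ∨ (pq.1 = o ∧ pq.2 ≠ o) ∨
      (pq.1 ≠ o ∧ pq.2 ≠ o ∧ (pq.1 = pq.2 ∨ r' pq.1 < r' pq.2))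
  have hE : ∀ p q, (p, q) ∈ E ↔
      ((p ≠ o ∧ q = o) ∨ (p = o ∧ q ≠ o) ∨ (p ≠ o ∧ q ≠ o ∧ (p = q ∨ r' p < r' q))) :=
    fun p q => by simp only [E, Finset.mem_filter, Finset.mem_univ, true_and]
  let s : Fin m' × Fin m' → k := fun pq => if pq.1 ≠ o ∧ pq.1 ≠ pq.2 then -1 else 1
  have hs : ∀ p q, s (p, q) = if p ≠ o ∧ p ≠ q then -1 else 1 := fun p q => rfl
  have hdet := det_signed_cover_eq_permanent (k := k) o r' E hE s hs
  refine ⟨E, _, rfl, ⟨s, fun pq => ?_, hdet⟩, ?_⟩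
  · simp only [s]
    split_ifs
    · exact Or.inr rfl
    · exact Or.inl rfl
  -- the projection
  let proj : Fin m' × Fin m' → MvPolynomial σ k := fun pq =>
    Sum.elim (fun u => Sum.elim (fun u' => if u = u' then 1 else Λ u u') (fun _ => w u) (e.symm pq.2))
      (fun _ => Sum.elim (fun u' => v u') (fun _ => 0) (e.symm pq.2)) (e.symm pq.1)
  have hproj : ∀ p' q' : ι ⊕ Unit, proj (e p', e q') =
      Sum.elim (fun u => Sum.elim (fun u' => if u = u' then 1 else Λ u u') (fun _ => w u) q')
        (fun _ => Sum.elim (fun u' => v u') (fun _ => 0) q') p' := fun p' q' => by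
    simp [proj]
  refine ⟨proj, fun pq => ?_, ?_⟩
  · -- every substituted value is a variable or a constant
    obtain ⟨p', hp'⟩ := e.surjective pq.1
    obtain ⟨q', hq'⟩ := e.surjective pq.2
    have : pq = (e p', e q') := Prod.ext hp'.symm hq'.symm
    rw [this, hproj]
    rcases p' with u | _ <;> rcases q' with u' | _
    · simp only [Sum.elim_inl]
      by_cases huu : u = u'
      · rw [if_pos huu]; exact Or.inr (Or.inr rfl)
      · rw [if_neg huu]; exact hΛe u u'
    · exact hw u
    · exact hv u'
    · exact Or.inr (Or.inl rfl)
  -- `aeval proj P = f`: map the SIGNED matrix (whose determinant is `P`) and compute a Schur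
  -- complement
  have hzero : ∀ i j, ¬ r i < r j → Λ i j = 0 := fun i j h => by
    by_contra h0
    exact h (hΛr i j h0)
  let M : Matrix (ι ⊕ Unit) (ι ⊕ Unit) (MvPolynomial σ k) :=
    Matrix.fromBlocks (1 - Λ) (-Matrix.replicateCol Unit w) (Matrix.replicateRow Unit v) 0
  have hmap : (aeval proj).mapMatrix
      (Matrix.of fun i j => if (i, j) ∈ E then C (s (i, j)) * X (i, j) else 0 :
        Matrix (Fin m') (Fin m') (MvPolynomial (Fin m' × Fin m') k)) =
      M.submatrix e.symm e.symm := by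
    ext p q
    obtain ⟨p', rfl⟩ := e.surjective p
    obtain ⟨q', rfl⟩ := e.surjective q
    simp only [AlgHom.mapMatrix_apply, Matrix.map_apply, Matrix.of_apply, Matrix.submatrix_apply,
      Equiv.symm_apply_apply]
    rw [apply_ite (aeval proj), map_zero, map_mul, aeval_C, aeval_X, hproj, hs,
      MvPolynomial.algebraMap_eq]
    have hmem := hE (e p') (e q')
    rcases p' with u | x <;> rcases q' with u' | y
    · -- internal block `1 - Λ`
      simp only [Sum.elim_inl, M, Matrix.fromBlocks_apply₁₁, Matrix.sub_apply]
      have ho1 : e (Sum.inl u) ≠ o := fun h => Sum.inl_ne_inr ((heo _).1 h)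
      have ho2 : e (Sum.inl u') ≠ o := fun h => Sum.inl_ne_inr ((heo _).1 h)
      by_cases huu : u = u'
      · subst huu
        rw [if_pos (hmem.2 (Or.inr (Or.inr ⟨ho1, ho1, Or.inl rfl⟩))), if_neg (fun h => h.2 rfl),
          if_pos rfl, Matrix.one_apply_eq, hzero u u (lt_irrefl _), sub_zero, C_1, one_mul]
      · have hne : e (Sum.inl u) ≠ e (Sum.inl u') := fun h => huu (Sum.inl_injective (e.injective h))
        rw [if_neg huu, Matrix.one_apply_ne huu, zero_sub]
        by_cases hr : r u < r u'
        · rw [if_pos (hmem.2 (Or.inr (Or.inr ⟨ho1, ho2, Or.inr (by rwa [hr', hr'])⟩))),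
            if_pos ⟨ho1, hne⟩, C_neg, C_1, neg_one_mul]
        · rw [hzero u u' hr, neg_zero, if_neg]
          intro h
          rcases hmem.1 h with h' | h' | h'
          · exact ho2 h'.2
          · exact ho1 h'.1
          · rcases h'.2.2 with h'' | h''
            · exact hne h''
            · rw [hr', hr'] at h''; exact hr h''
    · -- column of the super-vertex: `-w`
      simp only [Sum.elim_inl, Sum.elim_inr, M, Matrix.fromBlocks_apply₁₂, Matrix.neg_apply,
        Matrix.replicateCol_apply]
      have ho1 : e (Sum.inl u) ≠ o := fun h => Sum.inl_ne_inr ((heo _).1 h)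
      have ho2 : e (Sum.inr y) = o := (heo _).2 rfl
      rw [if_pos (hmem.2 (Or.inl ⟨ho1, ho2⟩)), if_pos ⟨ho1, fun h => ho1 (h.trans ho2)⟩, C_neg, C_1,
        neg_one_mul]
    · -- row of the super-vertex: `v`
      simp only [Sum.elim_inl, Sum.elim_inr, M, Matrix.fromBlocks_apply₂₁,
        Matrix.replicateRow_apply]
      have ho1 : e (Sum.inr x) = o := (heo _).2 rfl
      have ho2 : e (Sum.inl u') ≠ o := fun h => Sum.inl_ne_inr ((heo _).1 h)
      rw [if_pos (hmem.2 (Or.inr (Or.inl ⟨ho1, ho2⟩))), if_neg (fun h => h.1 ho1), C_1, one_mul]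
    · simp only [Sum.elim_inr, M, Matrix.fromBlocks_apply₂₂, Matrix.zero_apply]
      have ho1 : e (Sum.inr x) = o := (heo _).2 rfl
      rw [if_neg (fun h => ?_)]
      rcases hmem.1 h with h' | h' | h'
      · exact h'.1 ho1
      · exact h'.2 ((heo _).2 rfl)
      · exact h'.1 ho1
  rw [← hdet, AlgHom.map_det, hmap, Matrix.det_submatrix_equiv_self]
  -- Schur complement of the unipotent block
  letI : Invertible (1 - Λ) := invertibleOfRightInverse _ _ hG
  have hinv : ⅟(1 - Λ) = G := invOf_eq_right_inv hG
  simp only [M]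
  rw [Matrix.det_fromBlocks₁₁, det_one_sub_eq_one_of_ranked r Λ hΛr, one_mul, Matrix.mul_neg,
    sub_neg_eq_add, zero_add, Matrix.mul_assoc, ← Matrix.replicateCol_mulVec,
    Matrix.replicateRow_mul_replicateCol, Matrix.det_unique, Matrix.of_apply, hinv, hf]


open Literature.Computability.AlgebraicComplexity in
/-- **stub 3 — support (M): Grenet's cover is 0/1 — PROVED.**  Grenet's subset-lattice program
(arc `S → insert j S` labelled `X (j, |S|)`, tree: `Grenet.pow_succ_eq_zero`,
`Grenet.adjugate_one_sub_empty_univ`, `Grenet.sum_ite_injective`) read in at `∅` and out at `univ`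
has value `per_n`; `exists_zeroOneCover_of_ranked` turns it into a 0/1 Pfaffian cover on
`2^n + 1 ≤ 2^(n+1)` + `2^n + 1` vertices. [cite: Grenet2011, Thm. 1] -/
theorem zeroOneGrenet :
    ∃ c₀ : ℕ, ∀ n : ℕ, ∃ m' : ℕ, m' ≤ 2 ^ (n + c₀) ∧
      ∃ (E' : Finset (Fin m' × Fin m')) (P' : MvPolynomial (Fin m' × Fin m') ℂ),
        P' = (Matrix.of fun i j => if (i, j) ∈ E' then MvPolynomial.X (i, j) else 0 :
          Matrix (Fin m') (Fin m') (MvPolynomial (Fin m' × Fin m') ℂ)).permanent ∧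
        (∃ s' : Fin m' × Fin m' → ℂ, (∀ e, s' e = 1 ∨ s' e = -1) ∧
          (Matrix.of fun i j => if (i, j) ∈ E' then MvPolynomial.C (s' (i, j)) * MvPolynomial.X (i, j)
            else 0 : Matrix (Fin m') (Fin m') (MvPolynomial (Fin m' × Fin m') ℂ)).det = P') ∧
        ∃ a : Fin m' × Fin m' → MvPolynomial (Fin n × Fin n) ℂ,
          (∀ e, (∃ j, a e = MvPolynomial.X j) ∨ a e = 0 ∨ a e = 1) ∧
          Literature.Computability.AlgebraicComplexity.perPoly (Fin n) ℂ = MvPolynomial.aeval a P' := by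
  classical
  refine ⟨1, fun n => ?_⟩
  -- Grenet's program over ℂ
  let wgt : Fin n → ℕ → MvPolynomial (Fin n × Fin n) ℂ := fun j c =>
    if h : c < n then X (j, ⟨c, h⟩) else 0
  let A : Matrix (Finset (Fin n)) (Finset (Fin n)) (MvPolynomial (Fin n × Fin n) ℂ) :=
    Matrix.of fun S T => ∑ j, if j ∉ S ∧ T = insert j S then wgt j S.card else 0
  have hA : ∀ S T, A S T = ∑ j, if j ∉ S ∧ T = insert j S then wgt j S.card else 0 :=
    fun S T => rfl
  have hentry : ∀ S T, (∃ j, j ∉ S ∧ T = insert j S ∧ A S T = wgt j S.card) ∨ A S T = 0 := by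
    intro S T
    by_cases h : ∃ j, j ∉ S ∧ T = insert j S
    · obtain ⟨j, hj, rfl⟩ := h
      refine Or.inl ⟨j, hj, rfl, ?_⟩
      rw [hA, Finset.sum_eq_single j]
      · rw [if_pos ⟨hj, rfl⟩]
      · intro j' _ hj'
        rw [if_neg]
        rintro ⟨-, heq⟩
        exact hj' ((Finset.insert_inj hj).mp heq).symm
      · intro h
        exact absurd (mem_univ j) h
    · right
      rw [hA]
      exact sum_eq_zero fun j _ => if_neg fun hj => h ⟨j, hj⟩
  have hΛr : ∀ S T, A S T ≠ 0 → S.card < T.card := by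
    intro S T hST
    rcases hentry S T with ⟨j, hj, rfl, -⟩ | h0
    · rw [card_insert_of_notMem hj]; exact Nat.lt_succ_self _
    · exact absurd h0 hST
  have hΛe : ∀ S T, (∃ x, A S T = X x) ∨ A S T = 0 ∨ A S T = 1 := by
    intro S T
    rcases hentry S T with ⟨j, hj, -, hw⟩ | h0
    · rw [hw]
      simp only [wgt]
      split_ifs
      · exact Or.inl ⟨_, rfl⟩
      · exact Or.inr (Or.inl rfl)
    · exact Or.inr (Or.inl h0)
  let G : Matrix (Finset (Fin n)) (Finset (Fin n)) (MvPolynomial (Fin n × Fin n) ℂ) :=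
    ∑ i ∈ range (n + 1), A ^ i
  have hG : (1 - A) * G = 1 := by
    simp only [G]
    rw [mul_neg_geom_sum, Grenet.pow_succ_eq_zero wgt hA, sub_zero]
  let v : Finset (Fin n) → MvPolynomial (Fin n × Fin n) ℂ := fun S => if S = ∅ then 1 else 0
  let w : Finset (Fin n) → MvPolynomial (Fin n × Fin n) ℂ := fun S => if S = univ then 1 else 0
  have hv : ∀ S, (∃ x, v S = X x) ∨ v S = 0 ∨ v S = 1 := fun S => by
    simp only [v]; split_ifs
    · exact Or.inr (Or.inr rfl)
    · exact Or.inr (Or.inl rfl)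
  have hw : ∀ S, (∃ x, w S = X x) ∨ w S = 0 ∨ w S = 1 := fun S => by
    simp only [w]; split_ifs
    · exact Or.inr (Or.inr rfl)
    · exact Or.inr (Or.inl rfl)
  have hadj : (1 - A).adjugate = G := by
    simp only [G]; exact Grenet.adjugate_one_sub wgt hA
  have hval : G ∅ univ = perPoly (Fin n) ℂ := by
    rw [← hadj, Grenet.adjugate_one_sub_empty_univ wgt hA, Grenet.sum_ite_injective,
      perPoly, Matrix.permanent]
    refine sum_congr rfl fun σ _ => prod_congr rfl fun t _ => ?_
    simp only [wgt]
    rw [dif_pos t.isLt, Matrix.mvPolynomialX_apply]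
  have hf : v ⬝ᵥ (G *ᵥ w) = perPoly (Fin n) ℂ := by
    rw [← hval]
    simp only [v, w, dotProduct, Matrix.mulVec, ite_mul, one_mul, zero_mul, mul_ite, mul_one,
      mul_zero, Finset.sum_ite_eq', Finset.mem_univ, if_true]
  obtain ⟨E, P, hP, hs, a, ha, hper⟩ :=
    exists_zeroOneCover_of_ranked (k := ℂ) Finset.card A G v w (perPoly (Fin n) ℂ)
      hΛr hΛe hv hw hG hf
  refine ⟨Fintype.card (Finset (Fin n)) + 1, ?_, E, P, hP, hs, a, ha, hper⟩
  rw [Fintype.card_finset, Fintype.card_fin, pow_succ]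
  have := Nat.one_le_two_pow (n := n)
  omega


end Grenet

end Summit.ValiantsHypothesis.ValiantsHypothesis.Theorems.PolyaContinued.LaplaceRigidity
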